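import Summits.QuantumFields.YangMills.Theorems.UnitScaleTiltProp7CombTrueStepDefectTwoBlock
import HarnessLib

/-!
# Route `UnitScaleTilt`, crux K1 «MinimiserStabilityRegPr» (stmt-QuantumFields-19200), route-R E′ (A′)-on-Σ, P-A2 (β), row «(n3)-comb» —
# (O2) GROUNDWORK, file F-5c: THE ONE-STEP DEFECT SUMMED OVER A PERIOD CELL —
# `Σ_{c ∈ cell_{k+1}} ‖DEF_k(c)‖² ≤ (210(2d+2)L)²·2d·α_k²·Σ_{b ∈ cell_k} ‖X_b‖²` for `N_k = L·N_{k+1}`-periodic `X` (tiling of the fine cell by blocks + periodic shift)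

«(O2) groundwork — not consumed by any displayed row before the freeze lifts» (★★OWNER `ym3-torus-plan` g29 RULINGS №20 (2), №22; «(II) GO» 06:26∕06:31Z).
Cell `ym3-torus`, D-0154 (3c) R3 twin-width seat `ym-routeR-w1` (gen 9); DESIGN memo `DESIGN-N3COMB-LINEAR-CORE-routeRw1g9.md` §1 row 4 + §2 (W1: one period cell), file list §5 F-5∕F-0.
THEOREMS ONLY (0 `def`, 0 `sorry`); `--supports stmt-QuantumFields-19200 --as helper`, count-neutral.  YM₃ on T³ is a ladder rung (R3), not the Clay problem; nothing here claims
`hMcomb`, `hMcomb₂`, (β), `hPA2`, `hcoS`, the stub, the crux, d = 4 or the mass gap.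

THE POINT.  The (II) design is typed on `ℤᵈ` (W1): the based pullbacks are periodic, print's comb tower of periodic data is periodic with the level period `N_k`, and every `ℓ²`
quantity is a sum over ONE period cell `{boxVec N_k t}` (MASTER §2; SIGNATURE-0's index set at level l is exactly such a cell).  This file supplies the two pieces of period-cell
bookkeeping the whole line uses — the TILING of the level-k cell by the `Lᵈ`-blocks of the level-(k+1) cell, and the SHIFT-INVARIANCE of a period-cell sum of a periodic function —
and applies them to ✓`Prop7CombTrueStepDefectTwoBlock.norm_trueStep_defect_le_twoBlock` (F-5b): the two blocks of the coarse bonds `(L•z, κ)`, `z` in the coarse cell, cover the fine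
cell `2d` times (the comb twin of ✓`Prop7TrueLinDefectBound.sum_nbhd_le` ∕ `sum_normSq_defect_le`).

WHAT IS PROVED (ns `…Theorems.Prop7CombTrueStepDefectCell`; every `d`, `L ≥ 1`, `N′ ≥ 1`).
* §1 `sum_cell_tiling` — `Σ_{t : Fin d → Fin (N′·L)} f (boxVec t) = Σ_{z : Fin d → Fin N′} Σ_{s : Fin d → Fin L} f (L•boxVec z + boxVec s)` (any `f : Site d → M`, additive commutative `M`).
* §2 `sum_cell_shift` — `Σ_{z : Fin d → Fin N′} g (boxVec z + e κ) = Σ_z g (boxVec z)` for `N′`-periodic `g`.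
* §3 ★★ `sum_cell_trueStep_defect_sq_le` — the title.
HONEST SCOPE.  Bookkeeping + F-5b; the window `α` is the uniform loop window over the cell.  Nothing of Bałaban's is asserted beyond the cited tree∕lit theorems.

References: T. Bałaban, CMP **98** (1985) 17–51 [Balaban1985Averaging] ((2) p.17, (42)–(43) pp.23–24, (124)–(126) p.36); CMP **109** (1987) 249–301 [Balaban1987RG1] ((0.1) p.251).
-/

noncomputable section

open scoped BigOperators

namespace Summit.QuantumFields.YangMills.Theorems.Prop7CombTrueStepDefectCell

open NormedSpace
open Literature.MathematicalPhysics.QuantumFieldTheory.Balaban1983to89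
open ExpMeanLog (eml)
open B7Prop1Explicit (Site Letter e hol seg treeWord boxVec gammaWord Wcx Xavg bavg expUnit)
open B7Prop2Explicit (avgIter unitaryUnits)
open B7Eq78Linearization (conjR)
open B7Prop3GeneralRotated (tsum)
open B7Prop3GeneralLinear (FhatCov Q0cov)
open Summit.QuantumFields.YangMills.Theorems.Prop7CombTrueStepDefectTwoBlock (norm_trueStep_defect_le_twoBlock)

section Bookkeeping

variable {d : ℕ}

/-! ## §1 Tiling of the fine period cell by the blocks of the coarse cell -/

/-- **TILING**: the cell `[0, N′L)ᵈ` is the disjoint union of the blocks `L•z + [0,L)ᵈ`, `z ∈ [0,N′)ᵈ`: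
`Σ_{t : Fin d → Fin (N′·L)} f (boxVec t) = Σ_{z} Σ_{s} f (L•boxVec z + boxVec s)`. [cite: Balaban1985Averaging, (2) p.17] -/
theorem sum_cell_tiling {M : Type*} [AddCommMonoid M] (N' L : ℕ) (hL : 1 ≤ L) (f : Site d → M) :
    ∑ t : Fin d → Fin (N' * L), f (boxVec (N' * L) t)
      = ∑ z : Fin d → Fin N', ∑ s : Fin d → Fin L, f ((L : ℤ) • boxVec N' z + boxVec L s) := by
  have hL0 : 0 < L := hL
  -- the coordinatewise `(z, s) ↦ L·z + s` bijection `[0,N′)ᵈ × [0,L)ᵈ ≃ [0,N′L)ᵈ`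
  let τ : (Fin d → Fin N') × (Fin d → Fin L) ≃ (Fin d → Fin (N' * L)) :=
    { toFun := fun p i => ⟨L * (p.1 i : ℕ) + (p.2 i : ℕ), by
        have h1 := (p.1 i).isLt; have h2 := (p.2 i).isLt
        calc L * (p.1 i : ℕ) + (p.2 i : ℕ) < L * (p.1 i : ℕ) + L := by omega
          _ = L * ((p.1 i : ℕ) + 1) := by ring
          _ ≤ L * N' := Nat.mul_le_mul_left _ h1
          _ = N' * L := Nat.mul_comm _ _⟩
      invFun := fun t => (fun i => ⟨(t i : ℕ) / L, by
          have h0 : (t i : ℕ) < N' * L := (t i).isLt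
          exact Nat.div_lt_of_lt_mul (lt_of_lt_of_eq h0 (Nat.mul_comm N' L))⟩,
        fun i => ⟨(t i : ℕ) % L, Nat.mod_lt _ hL0⟩)
      left_inv := fun p => by
        ext i
        · simp only
          rw [Nat.add_comm, Nat.add_mul_div_left _ _ hL0, Nat.div_eq_of_lt (p.2 i).isLt, Nat.zero_add]
        · simp only
          rw [Nat.add_comm, Nat.add_mul_mod_self_left, Nat.mod_eq_of_lt (p.2 i).isLt]
      right_inv := fun t => by
        ext i
        simp only
        exact Nat.div_add_mod (t i : ℕ) L }
  have hτ : ∀ p : (Fin d → Fin N') × (Fin d → Fin L), boxVec (N' * L) (τ p) = (L : ℤ) • boxVec N' p.1 + boxVec L p.2 := by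
    intro p; funext i
    simp only [boxVec, Pi.add_apply, Pi.smul_apply, smul_eq_mul, τ, Equiv.coe_fn_mk]
    push_cast; ring
  rw [← Fintype.sum_prod_type']
  exact (Fintype.sum_equiv τ _ _ (fun p => by rw [hτ])).symm

/-! ## §2 Shift-invariance of a period-cell sum of a periodic function -/

/-- **SHIFT**: for an `N′`-periodic `g` (period `N′` in the direction `κ`), `Σ_{z : Fin d → Fin N′} g (boxVec z + e κ) = Σ_z g (boxVec z)` — the unit shift permutes the cell up
to one wrap-around, absorbed by periodicity. [cite: Balaban1987RG1, (0.1) p.251] -/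
theorem sum_cell_shift {M : Type*} [AddCommMonoid M] (N' : ℕ) [NeZero N'] (g : Site d → M) (κ : Fin d)
    (hg : ∀ x : Site d, g (x + (N' : ℤ) • e κ) = g x) :
    ∑ z : Fin d → Fin N', g (boxVec N' z + e κ) = ∑ z : Fin d → Fin N', g (boxVec N' z) := by
  -- the rotation of the κ-th coordinate
  let ρ : (Fin d → Fin N') ≃ (Fin d → Fin N') :=
    { toFun := fun t => Function.update t κ (t κ + 1)
      invFun := fun t => Function.update t κ (t κ - 1)
      left_inv := fun t => by
        ext i; by_cases hi : i = κ
        · subst hi; simp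
        · simp [Function.update_of_ne hi]
      right_inv := fun t => by
        ext i; by_cases hi : i = κ
        · subst hi; simp
        · simp [Function.update_of_ne hi] }
  refine Fintype.sum_equiv ρ _ _ fun t => ?_
  -- `boxVec (ρ t) = boxVec t + e κ` or `boxVec t + e κ − N′•e κ` (wrap-around)
  by_cases hwrap : (t κ : ℕ) + 1 < N'
  · congr 1
    funext i
    simp only [boxVec, Pi.add_apply, ρ, Equiv.coe_fn_mk, B7Prop1Explicit.e_apply]
    by_cases hi : i = κ
    · subst hi
      rw [Function.update_self, if_pos rfl, Fin.val_add_one_of_lt' (by simpa using hwrap)]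
      push_cast; ring
    · rw [Function.update_of_ne hi, if_neg hi, add_zero]
  · have hlast : (t κ : ℕ) + 1 = N' := by have := (t κ).isLt; omega
    have hρ : boxVec N' (ρ t) = boxVec N' t + e κ + -((N' : ℤ) • e κ) := by
      funext i
      simp only [boxVec, Pi.add_apply, Pi.neg_apply, Pi.smul_apply, smul_eq_mul, ρ, Equiv.coe_fn_mk, B7Prop1Explicit.e_apply]
      by_cases hi : i = κ
      · subst hi
        rw [Function.update_self, if_pos rfl]
        have hz : ((t i + 1 : Fin N') : ℕ) = 0 := by
          rw [Fin.val_add, Fin.val_one', Nat.add_mod_mod, hlast, Nat.mod_self]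
        rw [hz]; push_cast; omega
      · rw [Function.update_of_ne hi, if_neg hi]; ring
    rw [hρ, ← sub_eq_add_neg, ← hg (boxVec N' t + e κ - (N' : ℤ) • e κ), sub_add_cancel]

end Bookkeeping

section Cell

variable {d : ℕ} {𝔸 : Type*} [CStarAlgebra 𝔸] [Nontrivial 𝔸]

/-! ## §3 ★★ The one-step defect summed over the coarse period cell -/

/-- ★★ **THE ONE-STEP DEFECT OVER A PERIOD CELL**: `X` a level-`k` field, `N_k = N′·L`-periodic in every direction; `V₀` unitary with every block loop of every coarse bond of the cell
within `α ≤ 1∕24` of `1`.  Then `Σ_{z ∈ [0,N′)ᵈ, κ} ‖DEF(L•z, κ)‖² ≤ (210·(2d+2)·L)²·α²·(2d)·Σ_{t ∈ [0,N′L)ᵈ, ν} ‖X(t, ν)‖²` — ✓F-5b squared, the second blocks shifted back into the cell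
by periodicity (§2), the blocks re-assembled into the fine cell (§1). The comb twin of ✓`Prop7TrueLinDefectBound.sum_normSq_defect_le`. «(O2) groundwork.»
[cite: Balaban1985Averaging, (2) p.17, (42)-(43) pp.23-24, (124)-(126) p.36] -/
theorem sum_cell_trueStep_defect_sq_le (L N' : ℕ) (hL : 1 ≤ L) [NeZero N'] (V₀ : Site d → Fin d → 𝔸ˣ) (hV₀ : ∀ x μ, V₀ x μ ∈ unitaryUnits 𝔸)
    (X : Site d → Fin d → 𝔸) (hX : ∀ (x : Site d) (κ μ : Fin d), X (x + ((N' * L : ℕ) : ℤ) • e κ) μ = X x μ) {α : ℝ}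
    (hα : ∀ (z : Fin d → Fin N') (κ : Fin d) (r : Fin d → Fin L), ‖((Wcx L V₀ ((L : ℤ) • boxVec N' z) κ (boxVec L r) : 𝔸ˣ) : 𝔸) - 1‖ ≤ α) (hα24 : α ≤ 1 / 24) :
    ∑ z : Fin d → Fin N', ∑ κ : Fin d,
      ‖fderiv ℂ (eml : ((Fin d → Fin L) → 𝔸) → 𝔸) (fun r => ((Wcx L V₀ ((L : ℤ) • boxVec N' z) κ (boxVec L r) : 𝔸ˣ) : 𝔸))
            (fun r => tsum V₀ X ((L : ℤ) • boxVec N' z) (gammaWord L κ (boxVec L r) ++ seg κ (-(L : ℤ))) * ((Wcx L V₀ ((L : ℤ) • boxVec N' z) κ (boxVec L r) : 𝔸ˣ) : 𝔸))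
            * (((expUnit (Xavg L V₀ ((L : ℤ) • boxVec N' z) κ))⁻¹ : 𝔸ˣ) : 𝔸)
          + ((expUnit (Xavg L V₀ ((L : ℤ) • boxVec N' z) κ) : 𝔸ˣ) : 𝔸) * tsum V₀ X ((L : ℤ) • boxVec N' z) (seg κ (L : ℤ))
            * (((expUnit (Xavg L V₀ ((L : ℤ) • boxVec N' z) κ))⁻¹ : 𝔸ˣ) : 𝔸)
          - (FhatCov L V₀ X ((L : ℤ) • boxVec N' z) - conjR (bavg L V₀ ((L : ℤ) • boxVec N' z) κ) (FhatCov L V₀ X ((L : ℤ) • boxVec N' z + (L : ℤ) • e κ))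
              + (L : ℝ) • Q0cov L V₀ X ((L : ℤ) • boxVec N' z) κ)‖ ^ 2
      ≤ (210 * ((2 * d + 2) * L)) ^ 2 * α ^ 2 * (2 * d) * ∑ t : Fin d → Fin (N' * L), ∑ ν : Fin d, ‖X (boxVec (N' * L) t) ν‖ ^ 2 := by
  -- letters: the block mass `A y = Σ_{s,ν} ‖X(y + s, ν)‖²` and the constant
  set A : Site d → ℝ := fun y => ∑ s : Fin d → Fin L, ∑ ν : Fin d, ‖X (y + boxVec L s) ν‖ ^ 2 with hA
  set C : ℝ := (210 * ((2 * d + 2) * L)) ^ 2 * α ^ 2 with hC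
  have hC0 : 0 ≤ C := by positivity
  have hA0 : ∀ y, 0 ≤ A y := fun y => by positivity
  -- pointwise: F-5b squared, the two-block mass split into the two blocks
  have hpt : ∀ (z : Fin d → Fin N') (κ : Fin d),
      ‖fderiv ℂ (eml : ((Fin d → Fin L) → 𝔸) → 𝔸) (fun r => ((Wcx L V₀ ((L : ℤ) • boxVec N' z) κ (boxVec L r) : 𝔸ˣ) : 𝔸))
            (fun r => tsum V₀ X ((L : ℤ) • boxVec N' z) (gammaWord L κ (boxVec L r) ++ seg κ (-(L : ℤ))) * ((Wcx L V₀ ((L : ℤ) • boxVec N' z) κ (boxVec L r) : 𝔸ˣ) : 𝔸))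
            * (((expUnit (Xavg L V₀ ((L : ℤ) • boxVec N' z) κ))⁻¹ : 𝔸ˣ) : 𝔸)
          + ((expUnit (Xavg L V₀ ((L : ℤ) • boxVec N' z) κ) : 𝔸ˣ) : 𝔸) * tsum V₀ X ((L : ℤ) • boxVec N' z) (seg κ (L : ℤ))
            * (((expUnit (Xavg L V₀ ((L : ℤ) • boxVec N' z) κ))⁻¹ : 𝔸ˣ) : 𝔸)
          - (FhatCov L V₀ X ((L : ℤ) • boxVec N' z) - conjR (bavg L V₀ ((L : ℤ) • boxVec N' z) κ) (FhatCov L V₀ X ((L : ℤ) • boxVec N' z + (L : ℤ) • e κ))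
              + (L : ℝ) • Q0cov L V₀ X ((L : ℤ) • boxVec N' z) κ)‖ ^ 2
        ≤ C * (A ((L : ℤ) • boxVec N' z) + A ((L : ℤ) • boxVec N' z + (L : ℤ) • e κ)) := by
    intro z κ
    have h := norm_trueStep_defect_le_twoBlock L hL V₀ hV₀ X ((L : ℤ) • boxVec N' z) κ (hα z κ) hα24
    have h2 := pow_le_pow_left₀ (norm_nonneg _) h 2
    refine h2.trans_eq ?_
    have hB : ∑ s : Fin d → Fin L, ∑ ν : Fin d, (‖X ((L : ℤ) • boxVec N' z + boxVec L s) ν‖ ^ 2 + ‖X ((L : ℤ) • boxVec N' z + (L : ℤ) • e κ + boxVec L s) ν‖ ^ 2)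
        = A ((L : ℤ) • boxVec N' z) + A ((L : ℤ) • boxVec N' z + (L : ℤ) • e κ) := by
      simp only [hA, Finset.sum_add_distrib]
    rw [mul_pow, mul_pow, mul_pow, Real.sq_sqrt (by positivity), hB, hC]
    ring
  -- the shifted blocks: `Σ_z A(L•z + L•e_κ) = Σ_z A(L•z)` by periodicity (period `N′` for `w ↦ A(L•w)`)
  have hshift : ∀ κ : Fin d, ∑ z : Fin d → Fin N', A ((L : ℤ) • boxVec N' z + (L : ℤ) • e κ) = ∑ z : Fin d → Fin N', A ((L : ℤ) • boxVec N' z) := by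
    intro κ
    have hper : ∀ w : Site d, A ((L : ℤ) • (w + (N' : ℤ) • e κ)) = A ((L : ℤ) • w) := by
      intro w
      simp only [hA]
      refine Finset.sum_congr rfl fun s _ => Finset.sum_congr rfl fun ν _ => ?_
      have e1 : (L : ℤ) • (w + (N' : ℤ) • e κ) + boxVec L s = ((L : ℤ) • w + boxVec L s) + ((N' * L : ℕ) : ℤ) • e κ := by
        rw [smul_add, smul_smul]; push_cast; rw [mul_comm (L : ℤ)]; abel
      rw [e1, hX]
    have h := sum_cell_shift N' (fun w => A ((L : ℤ) • w)) κ hper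
    simp only [smul_add] at h
    exact h
  -- the unshifted blocks tile the fine cell
  have htile : ∑ z : Fin d → Fin N', A ((L : ℤ) • boxVec N' z) = ∑ t : Fin d → Fin (N' * L), ∑ ν : Fin d, ‖X (boxVec (N' * L) t) ν‖ ^ 2 := by
    simp only [hA]
    rw [sum_cell_tiling N' L hL (fun y => ∑ ν : Fin d, ‖X y ν‖ ^ 2)]
  set S : ℝ := ∑ z : Fin d → Fin N', A ((L : ℤ) • boxVec N' z) with hS
  -- sum over the coarse cell: `Σ_z Σ_κ (A(q_z) + A(q_z + Le_κ)) = d·S + d·S`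
  have hsum1 : ∑ z : Fin d → Fin N', ∑ κ : Fin d, A ((L : ℤ) • boxVec N' z) = (d : ℝ) * S := by
    rw [hS, Finset.mul_sum]
    refine Finset.sum_congr rfl fun z _ => ?_
    rw [Finset.sum_const, Finset.card_univ, Fintype.card_fin, nsmul_eq_mul]
  have hsum2 : ∑ z : Fin d → Fin N', ∑ κ : Fin d, A ((L : ℤ) • boxVec N' z + (L : ℤ) • e κ) = (d : ℝ) * S := by
    rw [Finset.sum_comm]
    simp only [hshift]
    rw [Finset.sum_const, Finset.card_univ, Fintype.card_fin, nsmul_eq_mul]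
  have htot : ∑ z : Fin d → Fin N', ∑ κ : Fin d, C * (A ((L : ℤ) • boxVec N' z) + A ((L : ℤ) • boxVec N' z + (L : ℤ) • e κ)) = C * (2 * d) * S := by
    have e1 : ∑ z : Fin d → Fin N', ∑ κ : Fin d, C * (A ((L : ℤ) • boxVec N' z) + A ((L : ℤ) • boxVec N' z + (L : ℤ) • e κ))
        = C * (∑ z : Fin d → Fin N', ∑ κ : Fin d, A ((L : ℤ) • boxVec N' z) + ∑ z : Fin d → Fin N', ∑ κ : Fin d, A ((L : ℤ) • boxVec N' z + (L : ℤ) • e κ)) := by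
      rw [← Finset.sum_add_distrib, Finset.mul_sum]
      refine Finset.sum_congr rfl fun z _ => ?_
      rw [← Finset.sum_add_distrib, Finset.mul_sum]
    rw [e1, hsum1, hsum2]; ring
  calc _ ≤ ∑ z : Fin d → Fin N', ∑ κ : Fin d, C * (A ((L : ℤ) • boxVec N' z) + A ((L : ℤ) • boxVec N' z + (L : ℤ) • e κ)) :=
        Finset.sum_le_sum fun z _ => Finset.sum_le_sum fun κ _ => hpt z κ
    _ = C * (2 * d) * S := htot
    _ = _ := by rw [hC, htile]

end Cell

end Summit.QuantumFields.YangMills.Theorems.Prop7CombTrueStepDefectCell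

end
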